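import Literature.Analysis.FunctionSpaces.TorusTrigPoly
import Literature.Analysis.FunctionSpaces.TorusFluidGlue
import HarnessLib

/-!
# The fractional (hypo- and hyper-dissipative) Navier–Stokes system on the flat torus

Analysis/FluidPDE definitions file. The system
`∂ₜv + div(v ⊗ v) + ∇p + ν(-Δ)^α v = 0`, `div v = 0` on `T^d × I` (`I` a time interval), where
`(-Δ)^α` is the Fourier multiplier with symbol `|k|^{2α}` on the `2π`-periodic torus
(Colombo–De Lellis–De Rosa 2018, §1 (NS); De Rosa 2019, §1; Luo–Titi 2020, §1 (1.1): symbol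
`|ξ|^{2θ}`, `ξ ∈ ℤ³`), is the standard one-parameter deformation of Navier–Stokes (`α = 1`) in
which the strength of the dissipation is varied: J.-L. Lions' exponent `α = 5/4` (= `(d+2)/4`,
`d = 3`) is where the energy becomes critical; below it the convex-integration non-uniqueness
theorems of Colombo–De Lellis–De Rosa (Leray solutions, `α < 1/5`), De Rosa (`α < 1/3`) and
Buckmaster–Vicol / Luo–Titi (`C⁰_t L²_x` weak solutions, `α < 5/4`) hold. This file supplies the
solution notions these statements are phrased in; the theorems themselves are vendored as named
facts in `Literature/Barriers/NavierStokesRegularity/`.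

## Design

* **Torus and normalisation.** As everywhere in the tree (`TorusFluidGlue`, `BuckmasterVicol`),
  the torus is Mathlib's unit torus `UnitAddTorus d = (ℝ/ℤ)^d` with characters
  `e^{2πi k·x} = UnitAddTorus.mFourier k` and probability Haar measure, so `-Δ e^{2πik·x} =
  4π²|k|² e^{2πik·x}` and the fractional Laplacian has symbol `Torus.fracSymbol α k =
  (4π²|k|²)^α = (2π|k|)^{2α}`. The sources use the `2π`-periodic torus with symbol `|k|^{2α}`;
  the two systems correspond under `x ↦ x/(2π)` together with the scaling symmetry
  `v ↦ λ^{2α-1} v(λ^{2α}t, λx)` of the fractional system (no fixed constants appear in it), so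
  existence/(non-)uniqueness statements transfer verbatim. This is recorded in each docstring.
* **`Torus.fracLaplacian α ψ`** — the spectral fractional Laplacian of a (smooth) real vector
  field, `x ↦ Re ∑_k (4π²|k|²)^α ψ̂(k) e^{2πik·x}` (`tsum` in `ℂ^d`, then the coordinatewise real
  part `EuclideanSpace.realPart`; for smooth real `ψ` the series converges absolutely and is
  real, so `Re` is the identity there). It is only ever applied to smooth test fields. Junk: for
  non-smooth `ψ` the `tsum` may be the junk value `0`.
* **`Torus.eFracDissipation α v = (4π²)^α |v|²_{Ḣ^α} ∈ [0, ∞]`** (via the tree's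
  `Torus.eHomSobolevSeminorm α`) — the dissipation `∫_{T^d} |(-Δ)^{α/2} v|² dx` in spectral form
  (Parseval on the probability torus), the quantity in the energy inequalities of Leray solutions
  (CDLDR (2)–(3); De Rosa (2)). For `α = 1` it is the in-tree `Torus.eGradNormSq`
  (`eFracDissipation_one`, by `rfl` up to `(4π²)^1 = 4π²`).
* **Weak solutions.** `Torus.IsWeakFracNSSolutionOn T α ν u` is the in-tree
  `Torus.IsWeakNSSolutionOn T ν u` (De Lellis–Székelyhidi / Buckmaster–Vicol distributional
  solutions on `T^d × (0,T)`, test fields smooth, divergence free, compactly supported in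
  `(0,T)`) with the viscous term `ν⟪u, Δψ⟫` replaced by `-ν⟪u, (-Δ)^α ψ⟫`; the `WithData`
  variant on `[0, ∞)` adds the datum term `∫⟪u₀, ψ(0)⟫` for test fields that may be non-zero at
  `t = 0` (CDLDR, §1: "`∫₀^∞∫ [(∂ₜ - (-Δ)^α)φ·v + Dφ : v⊗v] = -∫ v̄·φ(·,0)` for every smooth test
  vector field `φ ∈ C^∞_c(T³ × ℝ, ℝ³)` with `div φ = 0`"); the `Line` variant is Luo–Titi's
  Def. 1.1 (`v ∈ C⁰_weak(ℝ; L²)` solving on `ℝ × T³` in the sense of distributions). The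
  in-tree sign convention is kept: `⟪u, (u·∇)ψ⟫ = u ⊗ u : Dψ`.
* **Leray solutions** (`Torus.IsLerayFracSolution α u₀ u`, CDLDR §1; `Torus.IsLerayHopfFracSolution`,
  De Rosa §1): weak solution with datum in `L^∞(ℝ⁺; L²) ∩ L²_loc(ℝ⁺; H^α)` (the latter via the
  tree's `Torus.MemL2Sobolev 0 T α` for every `T`; see the docstring of `IsLerayFracSolution` for
  why the source's `L²(ℝ⁺; H^α)` must be read locally) obeying the energy inequality from `0` for
  all `t ≥ 0` and from a.e. `s ≥ 0` for all `t > s` (CDLDR (2), (3)); De Rosa requires it for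
  *all* `0 ≤ s < t` (his (2)), which is `IsLerayHopfFracSolution`. Energies are written in
  `[0, ∞]` (`Torus.eL2NormSq = ∫⁻‖v‖ₑ²`, twice `Torus.kineticEnergy`, plus the `lintegral` of
  `eFracDissipation`) to avoid real-valued junk. The tree's own Leray–Hopf notions for `α = 1`,
  `Torus.IsLerayHopfOn` / `Torus.IsGlobalLerayHopf` (`FluidPDE/LerayHopf.lean`: forced, Galdi-style,
  with weak `L²`-continuity and strong attainment of the datum), are a different (stronger)
  packaging; nothing here is identified with them.

Mathlib has no Navier–Stokes or fractional-Laplacian-on-the-torus notions (searched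
`fracLaplacian`, `fractionalLaplacian`, `NavierStokes`: only the lattice `fracLaplacianZd` of
`Barriers/CriticalPhenomena/RigorousRGSmallParameter`, unrelated).

## References

* M. Colombo, C. De Lellis, L. De Rosa, *Ill-posedness of Leray solutions for the hypodissipative
  Navier–Stokes equations*, Comm. Math. Phys. 362 (2018), 659–688, §1. [`ColomboDelellisDerosa2018`]
* L. De Rosa, *Infinitely many Leray–Hopf solutions for the fractional Navier–Stokes equations*,
  Comm. PDE 44 (2019), 335–365, §1. [`Derosa2018`]
* T. Luo, E. S. Titi, *Non-uniqueness of weak solutions to hyperviscous Navier–Stokes equations: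
  on sharpness of J.-L. Lions exponent*, Calc. Var. PDE 59 (2020), §1 (1.1), Def. 1.1.
  [`LuoTiti2020`]
* T. Buckmaster, V. Vicol, Ann. of Math. 189 (2019), Def. 1.1. [`BuckmasterVicol2019AnnMath`]
-/

noncomputable section

open MeasureTheory Set Filter Topology UnitAddTorus
open scoped ENNReal NNReal InnerProductSpace ContDiff

namespace Literature.Analysis.FluidPDE

namespace Torus

variable {d : Type*} [Fintype d]

/-! ## The fractional Laplacian on the unit torus -/

/-- The symbol of `(-Δ)^α` on the unit torus at the frequency `k ∈ ℤ^d`: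
`σ_α(k) = (4π²|k|²)^α = (2π|k|)^{2α}` (the character `e^{2πik·x}` is an eigenfunction of `-Δ`
with eigenvalue `4π²|k|²`; on the `2π`-periodic torus of the sources the symbol reads
`|k|^{2α}`). At `k = 0` the value is `0` for `α ≠ 0` (`Real.zero_rpow`).
[cite: ColomboDelellisDerosa2018, §1 (NS) and the display after it] -/
def fracSymbol (α : ℝ) (k : d → ℤ) : ℝ :=
  (4 * Real.pi ^ 2 * FunctionSpaces.Torus.freqNormSq k) ^ α

/-- The symbol is non-negative. [folklore] -/
theorem fracSymbol_nonneg (α : ℝ) (k : d → ℤ) : 0 ≤ fracSymbol α k :=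
  Real.rpow_nonneg (by have := FunctionSpaces.Torus.freqNormSq_nonneg k; positivity) α

/-- At `α = 1` the symbol is the Laplacian eigenvalue `4π²|k|²`. [folklore] -/
theorem fracSymbol_one (k : d → ℤ) : fracSymbol 1 k = 4 * Real.pi ^ 2 * FunctionSpaces.Torus.freqNormSq k := by
  simp [fracSymbol]

/-- The zero mode is annihilated for `α ≠ 0`: `σ_α(0) = 0`. [folklore] -/
theorem fracSymbol_zero {α : ℝ} (hα : α ≠ 0) : fracSymbol α (0 : d → ℤ) = 0 := by
  simp [fracSymbol, FunctionSpaces.Torus.freqNormSq_zero, Real.zero_rpow hα]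

/-- **The spectral fractional Laplacian** of a real vector field on the unit torus:
`((-Δ)^α ψ)(x) = Re ∑_{k ∈ ℤ^d} (4π²|k|²)^α ψ̂(k) e^{2πi k·x}`, where
`ψ̂(k) = mFourierCoeff (complexify ∘ ψ) k ∈ ℂ^d` are the Fourier coefficients of the complexified
field and `Re` is the coordinatewise real part. Intended for smooth `ψ` (the series then
converges absolutely and its sum is real); for other `ψ` the `tsum` junk convention applies.
The sources' definition, "`-(-Δ)^α f(x) = -∑_{k∈ℤ³} |k|^{2α} f̂_k e^{ik·x}`", in the unit-torus
normalisation. [cite: ColomboDelellisDerosa2018, §1 display after (NS)] -/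
def fracLaplacian (α : ℝ) (ψ : UnitAddTorus d → EuclideanSpace ℝ d) (x : UnitAddTorus d) :
    EuclideanSpace ℝ d :=
  FunctionSpaces.EuclideanSpace.realPart
    (∑' k : d → ℤ, fracSymbol α k • (mFourier k x • mFourierCoeff (FunctionSpaces.EuclideanSpace.complexify ∘ ψ) k))

/-- Unfolding `fracLaplacian`. [folklore] -/
theorem fracLaplacian_def (α : ℝ) (ψ : UnitAddTorus d → EuclideanSpace ℝ d) (x : UnitAddTorus d) :
    fracLaplacian α ψ x = FunctionSpaces.EuclideanSpace.realPart (∑' k : d → ℤ,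
      fracSymbol α k • (mFourier k x • mFourierCoeff (FunctionSpaces.EuclideanSpace.complexify ∘ ψ) k)) :=
  rfl

/-- The fractional Laplacian of the zero field is zero. [folklore] -/
theorem fracLaplacian_zero_fun (α : ℝ) :
    fracLaplacian α (0 : UnitAddTorus d → EuclideanSpace ℝ d) = 0 := by
  funext x
  have h : (FunctionSpaces.EuclideanSpace.complexify ∘ (0 : UnitAddTorus d → EuclideanSpace ℝ d)) = 0 := by
    funext y; simp
  simp [fracLaplacian, mFourierCoeff]

/-- **The fractional dissipation** `∫_{T^d} |(-Δ)^{α/2} v|² dx = (4π²)^α ∑_{k ≠ 0} |k|^{2α} ‖v̂(k)‖²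
∈ [0,∞]` of a real vector field, in spectral form (Parseval on the probability torus; the
integrand of the dissipative term in the energy inequalities (2)–(3) of Colombo–De Lellis–De Rosa),
written through the tree's homogeneous seminorm `Torus.eHomSobolevSeminorm α` of the complexified
field exactly as the tree's `α = 1` case `Torus.eGradNormSq` (`eFracDissipation_one`); the
omitted zero mode carries the factor `|0|^{2α} = 0` anyway for `α > 0`. **Junk note:** Fourier
coefficients are Bochner integrals, hence `0` for non-integrable `v`.
[cite: ColomboDelellisDerosa2018, §1 (2)–(3)] -/
def eFracDissipation (α : ℝ) (v : UnitAddTorus d → EuclideanSpace ℝ d) : ℝ≥0∞ :=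
  ENNReal.ofReal ((4 * Real.pi ^ 2) ^ α) * FunctionSpaces.Torus.eHomSobolevSeminorm α (FunctionSpaces.EuclideanSpace.complexify ∘ v) ^ 2

/-- At `α = 1` the fractional dissipation is the tree's spectral squared gradient norm
`Torus.eGradNormSq v = 4π² |v|²_{Ḣ¹}` (same formula). [folklore] -/
theorem eFracDissipation_one (v : UnitAddTorus d → EuclideanSpace ℝ d) :
    eFracDissipation 1 v = FunctionSpaces.Torus.eGradNormSq v := by
  simp [eFracDissipation, FunctionSpaces.Torus.eGradNormSq, Real.rpow_one]

/-- The zero field dissipates nothing. [folklore] -/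
theorem eFracDissipation_zero_fun (α : ℝ) :
    eFracDissipation α (0 : UnitAddTorus d → EuclideanSpace ℝ d) = 0 := by
  have h : (FunctionSpaces.EuclideanSpace.complexify ∘ (0 : UnitAddTorus d → EuclideanSpace ℝ d)) = 0 := by
    funext y; simp
  simp [eFracDissipation, FunctionSpaces.Torus.eHomSobolevSeminorm, mFourierCoeff]

/-- The squared `L²` norm `∫_{T^d} ‖v(x)‖² dx ∈ [0, ∞]` of a field (lower integral, no junk):
TWICE the kinetic energy `Torus.kineticEnergy v = ½∫‖v‖²` of `TorusFluidGlue` (there a real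
Bochner integral), and equal to `eLpNorm v 2 volume ^ 2`. Used to write the energy inequalities
in `[0, ∞]`. [folklore] -/
def eL2NormSq (v : UnitAddTorus d → EuclideanSpace ℝ d) : ℝ≥0∞ :=
  ∫⁻ x, ‖v x‖ₑ ^ 2

/-- The zero field has zero `L²` norm. [folklore] -/
theorem eL2NormSq_zero_fun : eL2NormSq (0 : UnitAddTorus d → EuclideanSpace ℝ d) = 0 := by
  simp [eL2NormSq]

variable [DecidableEq d]

/-! ## Weak solutions of the fractional system -/

/-- **Distributional solutions of the fractional Navier–Stokes system on `T^d × (0, T)`**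
(`∂ₜu + div(u ⊗ u) + ∇p + ν(-Δ)^α u = 0`, `div u = 0`): exactly the in-tree
`Torus.IsWeakNSSolutionOn T ν u` (measurable, `u ∈ L²_{t,x}`, weakly divergence free for a.e.
`t`, and the weak momentum identity against smooth divergence-free test fields compactly
supported in time in `(0,T)`) with the viscous term `ν⟪u, Δψ⟫` replaced by `-ν⟪u, (-Δ)^α ψ⟫`:
`∫₀ᵀ ∫ (⟪u, ∂ₜψ⟫ + ⟪u, (u·∇)ψ⟫ - ν⟪u, (-Δ)^α ψ⟫) dx dt = 0` (Buckmaster–Vicol Def. 1.1 /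
Luo–Titi Def. 1.1 on a finite interval). Mean zero is not imposed (add `Torus.HasZeroMean`
where a source requires it). [cite: LuoTiti2020, §1 (1.1) and Def. 1.1] -/
def IsWeakFracNSSolutionOn (T α ν : ℝ) (u : ℝ → UnitAddTorus d → EuclideanSpace ℝ d) : Prop :=
  AEStronglyMeasurable (FunctionSpaces.Torus.stLift u) (volume.restrict (Ioo 0 T ×ˢ univ)) ∧
    (∫⁻ t in Ioo 0 T, ∫⁻ x, ‖u t x‖ₑ ^ 2 < ⊤) ∧
    (∀ᵐ t ∂(volume.restrict (Ioo 0 T)), FunctionSpaces.Torus.IsWeaklyDivFree (u t)) ∧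
    ∀ ψ : ℝ → UnitAddTorus d → EuclideanSpace ℝ d, FunctionSpaces.Torus.IsSpaceTimeTestIoo T ψ → FunctionSpaces.Torus.IsDivFreeTest ψ →
      ∫ t in Ioo 0 T, ∫ x, (⟪u t x, FunctionSpaces.Torus.timeDeriv ψ t x⟫_ℝ + ⟪u t x, FunctionSpaces.Torus.convect (u t) (ψ t) x⟫_ℝ -
        ν * ⟪u t x, fracLaplacian α (ψ t) x⟫_ℝ) = 0

/-- **Distributional solutions of the fractional system on `T^d × [0, ∞)` with initial datum
`u₀`** (Colombo–De Lellis–De Rosa 2018, §1: "`∫₀^∞ ∫ [(∂ₜ - (-Δ)^α)φ · v + Dφ : v ⊗ v] dx ds =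
-∫ v̄(x)·φ(x,0) dx` for every smooth test vector field `φ ∈ C^∞_c(T³ × ℝ, ℝ³)` with `div φ = 0`";
De Rosa 2019, §1, same display): `u` is measurable and locally `L²` on `(0,∞) × T^d`, weakly
divergence free for a.e. `t > 0`, and for every smooth divergence-free test field `ψ` with
compact support in time (`IsSpaceTimeTest T' ψ` for some `T'`: smooth on `ℝ × ℝ^d`, vanishing for
large times, possibly non-zero at `t = 0`)
`∫₀^∞ ∫ (⟪u, ∂ₜψ⟫ + ⟪u, (u·∇)ψ⟫ - ν⟪u, (-Δ)^α ψ⟫) dx dt + ∫ ⟪u₀, ψ(0)⟫ dx = 0`.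
[cite: ColomboDelellisDerosa2018, §1 (weak solution with initial data, display after Thm. 1.1)] -/
def IsWeakFracNSSolutionWithData (α ν : ℝ) (u₀ : UnitAddTorus d → EuclideanSpace ℝ d)
    (u : ℝ → UnitAddTorus d → EuclideanSpace ℝ d) : Prop :=
  AEStronglyMeasurable (FunctionSpaces.Torus.stLift u) (volume.restrict (Ioi 0 ×ˢ univ)) ∧
    (∀ T : ℝ, ∫⁻ t in Ioo 0 T, ∫⁻ x, ‖u t x‖ₑ ^ 2 < ⊤) ∧
    (∀ᵐ t ∂(volume.restrict (Ioi 0)), FunctionSpaces.Torus.IsWeaklyDivFree (u t)) ∧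
    ∀ ψ : ℝ → UnitAddTorus d → EuclideanSpace ℝ d, (∃ T' : ℝ, FunctionSpaces.Torus.IsSpaceTimeTest T' ψ) →
      FunctionSpaces.Torus.IsDivFreeTest ψ →
      (∫ t in Ioi 0, ∫ x, (⟪u t x, FunctionSpaces.Torus.timeDeriv ψ t x⟫_ℝ + ⟪u t x, FunctionSpaces.Torus.convect (u t) (ψ t) x⟫_ℝ -
        ν * ⟪u t x, fracLaplacian α (ψ t) x⟫_ℝ)) + ∫ x, ⟪u₀ x, ψ 0 x⟫_ℝ = 0

/-- **Weak solutions on the whole time line** (Luo–Titi 2020, Def. 1.1: "A vector field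
`v ∈ C⁰_weak(ℝ; L²(T³))` is called a weak solution to the FVNSE if it solves (1.1) in the sense
of distribution"): every time slice is in `L²`, `t ↦ ∫⟪v(t), φ⟫` is continuous for every `L²`
field `φ` (weak continuity), `v(t)` is weakly divergence free, `v` is measurable on `ℝ × T^d`,
and the weak momentum identity holds against all smooth divergence-free test fields with
compact support in time (`ψ t = 0` off a bounded interval).
[cite: LuoTiti2020, §1 Def. 1.1] -/
def IsWeakFracNSSolutionLine (α ν : ℝ) (v : ℝ → UnitAddTorus d → EuclideanSpace ℝ d) : Prop :=
  AEStronglyMeasurable (FunctionSpaces.Torus.stLift v) volume ∧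
    (∀ t, MemLp (v t) 2 volume) ∧
    (∀ φ : UnitAddTorus d → EuclideanSpace ℝ d, MemLp φ 2 volume →
      Continuous fun t => ∫ x, ⟪v t x, φ x⟫_ℝ) ∧
    (∀ t, FunctionSpaces.Torus.IsWeaklyDivFree (v t)) ∧
    ∀ ψ : ℝ → UnitAddTorus d → EuclideanSpace ℝ d, ContDiff ℝ ∞ (FunctionSpaces.Torus.stLift ψ) →
      (∃ a b : ℝ, ∀ t, t ∉ Icc a b → ψ t = 0) → FunctionSpaces.Torus.IsDivFreeTest ψ →
      ∫ t, ∫ x, (⟪v t x, FunctionSpaces.Torus.timeDeriv ψ t x⟫_ℝ + ⟪v t x, FunctionSpaces.Torus.convect (v t) (ψ t) x⟫_ℝ -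
        ν * ⟪v t x, fracLaplacian α (ψ t) x⟫_ℝ) = 0

/-! ## Leray solutions -/

/-- The **energy inequality between times `s < t`** for the fractional system (viscosity `1`):
`½∫|u(t)|² + ∫ₛᵗ ∫ |(-Δ)^{α/2} u|² ≤ ½∫|u(s)|²`, written in `[0, ∞]` (CDLDR (3); De Rosa (2)).
[cite: ColomboDelellisDerosa2018, §1 (3)] -/
def FracEnergyIneq (α : ℝ) (u : ℝ → UnitAddTorus d → EuclideanSpace ℝ d) (s t : ℝ) : Prop :=
  2⁻¹ * eL2NormSq (u t) + ∫⁻ τ in Ioo s t, eFracDissipation α (u τ) ≤ 2⁻¹ * eL2NormSq (u s)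

/-- **Leray solutions of the fractional Navier–Stokes system** (Colombo–De Lellis–De Rosa 2018,
§1, "solutions of the Cauchy problem `v(·,0) = v̄` of (NS) defined on `T³ × ℝ⁺` and satisfying
(2) and (3) will be called Leray solutions"; viscosity `1` as printed): a weak solution with
datum `u₀` on `[0,∞)` in the class `L^∞(ℝ⁺; L²(T^d)) ∩ L²(ℝ⁺; H^α(T^d))` (Thm. 1.1) such that
(2) `½∫|u(t)|² + ∫₀ᵗ∫|(-Δ)^{α/2}u|² ≤ ½∫|u₀|²` for every `t ≥ 0` and
(3) for a.e. `s ≥ 0` and every `t > s`, `½∫|u(t)|² + ∫ₛᵗ∫|(-Δ)^{α/2}u|² ≤ ½∫|u(s)|²`.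
(CDLDR interpret (2) pointwise in `t` via the weakly continuous representative; here `u` is a
genuine function of `t` and (2) is required at every `t ≥ 0`.) The class `L²(ℝ⁺; H^α)` of the
source is read LOCALLY in time — `u ∈ L²(0,T; H^α)` for every `T`, the tree's
`Torus.MemL2Sobolev 0 T α` of the complexified field, as in the tree's `Torus.IsLerayHopfOn` for
`α = 1` — since the global-in-time bound is available only for the homogeneous part (it is
inequality (2): `∫₀^∞∫|(-Δ)^{α/2}u|² ≤ ½∫|u₀|²`), while the inhomogeneous `H^α` norm of e.g. the
constant solutions is not square integrable on `(0, ∞)`. Compared with the tree's Leray–Hopf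
notion `Torus.IsLerayHopfOn` / `Torus.IsGlobalLerayHopf` (`FluidPDE/LerayHopf.lean`, `α = 1`,
forced, with weak `L²`-continuity and strong attainment of the datum), the present class asks
neither continuity property (CDLDR do not). [cite: ColomboDelellisDerosa2018, §1 Thm. 1.1 and (2)–(3)] -/
def IsLerayFracSolution (α : ℝ) (u₀ : UnitAddTorus d → EuclideanSpace ℝ d)
    (u : ℝ → UnitAddTorus d → EuclideanSpace ℝ d) : Prop :=
  IsWeakFracNSSolutionWithData α 1 u₀ u ∧
    (∃ C : ℝ≥0∞, C < ⊤ ∧ ∀ᵐ t ∂(volume.restrict (Ioi 0)), eL2NormSq (u t) ≤ C) ∧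
    (∀ T : ℝ, 0 < T → FunctionSpaces.Torus.MemL2Sobolev 0 T α (fun t => FunctionSpaces.EuclideanSpace.complexify ∘ u t)) ∧
    (∀ t : ℝ, 0 ≤ t →
      2⁻¹ * eL2NormSq (u t) + ∫⁻ τ in Ioo 0 t, eFracDissipation α (u τ) ≤ 2⁻¹ * eL2NormSq u₀) ∧
    (∀ᵐ s ∂(volume.restrict (Ioi 0)), ∀ t : ℝ, s < t → FracEnergyIneq α u s t)

/-- **Leray–Hopf solutions in De Rosa's sense** (De Rosa 2019, §1: weak solution with datum in
`L^∞(ℝ⁺; L²) ∩ L²(ℝ⁺; H^γ)` "obeying to the global energy inequality … `∀ 0 ≤ s < t`"): as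
`IsLerayFracSolution` but with the energy inequality between *all* pairs of times
`0 ≤ s < t` (with `u 0` read as the datum `u₀` at `s = 0`). [cite: Derosa2018, §1 (2)] -/
def IsLerayHopfFracSolution (α : ℝ) (u₀ : UnitAddTorus d → EuclideanSpace ℝ d)
    (u : ℝ → UnitAddTorus d → EuclideanSpace ℝ d) : Prop :=
  IsWeakFracNSSolutionWithData α 1 u₀ u ∧
    (∃ C : ℝ≥0∞, C < ⊤ ∧ ∀ᵐ t ∂(volume.restrict (Ioi 0)), eL2NormSq (u t) ≤ C) ∧
    (∀ T : ℝ, 0 < T → FunctionSpaces.Torus.MemL2Sobolev 0 T α (fun t => FunctionSpaces.EuclideanSpace.complexify ∘ u t)) ∧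
    (∀ t : ℝ, 0 < t →
      2⁻¹ * eL2NormSq (u t) + ∫⁻ τ in Ioo 0 t, eFracDissipation α (u τ) ≤ 2⁻¹ * eL2NormSq u₀) ∧
    (∀ s t : ℝ, 0 < s → s < t → FracEnergyIneq α u s t)

/-- De Rosa's Leray–Hopf solutions are Leray solutions in the sense of Colombo–De Lellis–De Rosa
(the energy inequality for all `s` implies it for a.e. `s`; at `t = 0` inequality (2) is the
trivial `½‖u₀‖² ≤ ½‖u₀‖²` once `u 0 = u₀`, which we do not assume — so we ask `0 < t` in the
hypothesis class and derive CDLDR's `0 ≤ t` form under `u 0 = u₀`). [folklore] -/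
theorem IsLerayHopfFracSolution.isLerayFracSolution {α : ℝ}
    {u₀ : UnitAddTorus d → EuclideanSpace ℝ d} {u : ℝ → UnitAddTorus d → EuclideanSpace ℝ d}
    (h : IsLerayHopfFracSolution α u₀ u) (h0 : u 0 = u₀) : IsLerayFracSolution α u₀ u := by
  refine ⟨h.1, h.2.1, h.2.2.1, fun t ht => ?_, ?_⟩
  · rcases ht.eq_or_lt with rfl | ht'
    · simp [h0]
    · exact h.2.2.2.1 t ht'
  · filter_upwards [ae_restrict_mem measurableSet_Ioi] with s hs t hst
    exact h.2.2.2.2 s t hs hst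

/-- **Infinitely many Leray solutions from one datum**, stated robustly: a sequence of Leray
solutions with the same datum, pairwise distinct AS SPACE-TIME FUNCTIONS MODULO NULL SETS on
`(0,∞) × T^d`, i.e. `∫₀^∞ ∫_{T^d} ‖v_m - v_n‖² ≠ 0` for `m ≠ n`. This is the sense in which the
sources count solutions: a weak solution in `L^∞(ℝ⁺;L²) ∩ L²(ℝ⁺;H^α)` is an a.e.-defined object
("can be redefined on a set of measure zero so that … `t ↦ v(·,t)` is weakly continuous", CDLDR
§1 p. 3). Testing distinctness at a single time would NOT do: `IsLerayFracSolution` imposes no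
time-continuity, its conjuncts are a.e. in time except the energy inequality (2), which is
monotone under shrinking one time slice, so rescaling a single slice of one Leray solution
produces spurious "different" Leray solutions; differing on a set of times of positive measure
cannot be so manufactured (the space–time weak formulation sees it).
[cite: ColomboDelellisDerosa2018, §1 p. 3 (paragraph after Thm. 1.1) and Thm. 1.2] -/
def HasInfinitelyManyLeraySolutions (α : ℝ) (u₀ : UnitAddTorus d → EuclideanSpace ℝ d) : Prop :=
  ∃ v : ℕ → ℝ → UnitAddTorus d → EuclideanSpace ℝ d,
    (∀ n, IsLerayFracSolution α u₀ (v n)) ∧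
    ∀ m n, m ≠ n → ∫⁻ t in Ioi 0, eL2NormSq (v m t - v n t) ≠ 0

end Torus

end Literature.Analysis.FluidPDE
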